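import Summits.MatrixMultiplication.OmegaCensus.DominoZpZpStructSevenCheck
import Summits.MatrixMultiplication.OmegaCensus.DominoZpZpStructSevenCore
import Summits.MatrixMultiplication.OmegaCensus.DominoZpZpStructFiveGen
import HarnessLib

/-!
# Structural cover theorem for part size `7` on `ZMod p × ZMod p` (`p ≤ 19`): normalised tuples, table check, assembly

ω-census `pub-omega`, family (b3), seat pub-omega-group gen 24.  Framing: lottery ticket; floor = certified bounds/negative
ranges.  VALUE: with `DominoZpZpStructSevenKeys/Core/Gen/Check.lean`, a kernel route to the part-`7` cells of the `ℤ_p²`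
column for `p + 1 < 21` — the OPEN census cells `(1,7,23)@484` ×2 (`p = 11`) — from a table of the normalised repeated count
vectors that are not excluded; NOT progress on ω.  Part-`7` copy of `DominoZpZpStructSix.lean` (codes in base `8`).

A GOOD septuple of line values (`exists_goodS7`: `a₀ = a₁`, key not in `E`) scaled by a unit is one of the NORMALISED REPEATED
tuples `(1,1,b,c,d,e,f)`, `(0,0,1,c,d,e,f)`, `(0,0,0,1,d,e,f)`, `(0,0,0,0,1,e,f)`, `(0,0,0,0,0,1,f)`, `(0,0,0,0,0,0,1)`, `0` with a
non-excluded count vector; `checkSeven p et tt` (by rows `checkSevenRow p et tt b`, `p⁴` lookups each, + `checkSevenRest`) checks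
that every such tuple is excluded (code `polyBE 8` in the SOUND code tree `et` of `E`) or a key of the table tree;
`exists_entry_structSeven_of_checks` delivers the scaled cover hypothesis for `|X| = 7` consumed by
`DominoZpZpCells.no_law_cube_1de_of_onto_zpzp_of_cover`.
-/

namespace Summit.MatrixMultiplication.OmegaCensus

open Finset

namespace ZpZpDomino

/-! ## Normalised repeated tuples, the table check, and its soundness -/

section Table

/-- One normalised tuple is fine if its count-vector code is excluded (in the code tree `et` of the excluded list) or a key of the
table tree `tt`. [folklore] -/
def okSeven (p : ℕ) (et tt : BTree) (n₀ n₁ n₂ n₃ n₄ n₅ n₆ : ℕ) : Bool :=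
  let cd := hornerS 8 (cv7 p n₀ n₁ n₂ n₃ n₄ n₅ n₆) 0
  et.mem cd || tt.mem cd

/-- Row `b` of the completeness check: the tuples `(1,1,b,c,d,e,f)`, `c, d, e, f < p`. [folklore] -/
def checkSevenRow (p : ℕ) (et tt : BTree) (b : ℕ) : Bool :=
  (List.range p).all fun c => (List.range p).all fun d => (List.range p).all fun e => (List.range p).all fun f =>
    okSeven p et tt 1 1 b c d e f

/-- The remaining normalised tuples `(0,0,1,c,d,e,f)`, `(0,0,0,1,d,e,f)`, `(0,0,0,0,1,e,f)`, `(0,0,0,0,0,1,f)`, `(0,0,0,0,0,0,1)`,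
`0`. [folklore] -/
def checkSevenRest (p : ℕ) (et tt : BTree) : Bool :=
  ((List.range p).all fun c => (List.range p).all fun d => (List.range p).all fun e => (List.range p).all fun f =>
      okSeven p et tt 0 0 1 c d e f) &&
    (((List.range p).all fun d => (List.range p).all fun e => (List.range p).all fun f => okSeven p et tt 0 0 0 1 d e f) &&
      (((List.range p).all fun e => (List.range p).all fun f => okSeven p et tt 0 0 0 0 1 e f) &&
        (((List.range p).all fun f => okSeven p et tt 0 0 0 0 0 1 f) &&
          (okSeven p et tt 0 0 0 0 0 0 1 && okSeven p et tt 0 0 0 0 0 0 0))))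

/-- **Completeness check** (`p⁵ + p⁴ + p³ + p² + p + 2` lookups). [folklore] -/
def checkSeven (p : ℕ) (et tt : BTree) : Bool :=
  ((List.range p).all fun b => checkSevenRow p et tt b) && checkSevenRest p et tt

/-- Assembling `checkSeven` from its rows. [folklore] -/
theorem checkSeven_of_rows {p : ℕ} {et tt : BTree} (hrows : ∀ b < p, checkSevenRow p et tt b = true)
    (hrest : checkSevenRest p et tt = true) : checkSeven p et tt = true := by
  rw [checkSeven, Bool.and_eq_true, List.all_eq_true]
  exact ⟨fun b hb => hrows b (List.mem_range.1 hb), hrest⟩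

/-- COLUMN-CHUNKED form of a row: the tuples `(1,1,b,c,d,e,f)` with `c₀ ≤ c < c₀ + n` (`n·p³` lookups; for `p = 13` a full
row of `p⁴` lookups is too much kernel work for one `decide`). [folklore] -/
def checkSevenRowCols (p : ℕ) (et tt : BTree) (b c₀ n : ℕ) : Bool :=
  (List.range' c₀ n).all fun c => (List.range p).all fun d => (List.range p).all fun e => (List.range p).all fun f =>
    okSeven p et tt 1 1 b c d e f

/-- A row is its full column range. [folklore] -/
theorem checkSevenRow_eq_cols (p : ℕ) (et tt : BTree) (b : ℕ) :
    checkSevenRow p et tt b = checkSevenRowCols p et tt b 0 p := by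
  simp only [checkSevenRow, checkSevenRowCols, List.range_eq_range']

/-- Gluing two adjacent column chunks. [folklore] -/
theorem checkSevenRowCols_split {p : ℕ} {et tt : BTree} {b c₀ m n : ℕ} (h₁ : checkSevenRowCols p et tt b c₀ m = true)
    (h₂ : checkSevenRowCols p et tt b (c₀ + m) n = true) : checkSevenRowCols p et tt b c₀ (m + n) = true := by
  simp only [checkSevenRowCols, ← List.range'_append_1, List.all_append, Bool.and_eq_true] at h₁ h₂ ⊢
  exact ⟨h₁, h₂⟩

/-- COLUMN-CHUNKED form of the first rest family: the tuples `(0,0,1,c,d,e,f)` with `c₀ ≤ c < c₀ + n`. [folklore] -/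
def checkSevenRestCols (p : ℕ) (et tt : BTree) (c₀ n : ℕ) : Bool :=
  (List.range' c₀ n).all fun c => (List.range p).all fun d => (List.range p).all fun e => (List.range p).all fun f =>
    okSeven p et tt 0 0 1 c d e f

/-- The small rest families `(0,0,0,1,d,e,f)`, `(0,0,0,0,1,e,f)`, `(0,0,0,0,0,1,f)`, `(0,0,0,0,0,0,1)`, `0` (`p³ + p² + p + 2` lookups). [folklore] -/
def checkSevenRestSmall (p : ℕ) (et tt : BTree) : Bool :=
  ((List.range p).all fun d => (List.range p).all fun e => (List.range p).all fun f => okSeven p et tt 0 0 0 1 d e f) &&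
    (((List.range p).all fun e => (List.range p).all fun f => okSeven p et tt 0 0 0 0 1 e f) &&
      (((List.range p).all fun f => okSeven p et tt 0 0 0 0 0 1 f) &&
        (okSeven p et tt 0 0 0 0 0 0 1 && okSeven p et tt 0 0 0 0 0 0 0)))

/-- Gluing two adjacent column chunks of the first rest family. [folklore] -/
theorem checkSevenRestCols_split {p : ℕ} {et tt : BTree} {c₀ m n : ℕ} (h₁ : checkSevenRestCols p et tt c₀ m = true)
    (h₂ : checkSevenRestCols p et tt (c₀ + m) n = true) : checkSevenRestCols p et tt c₀ (m + n) = true := by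
  simp only [checkSevenRestCols, ← List.range'_append_1, List.all_append, Bool.and_eq_true] at h₁ h₂ ⊢
  exact ⟨h₁, h₂⟩

/-- The rest check from its chunked first family and the small families. [folklore] -/
theorem checkSevenRest_of_parts {p : ℕ} {et tt : BTree} (h₁ : checkSevenRestCols p et tt 0 p = true)
    (h₂ : checkSevenRestSmall p et tt = true) : checkSevenRest p et tt = true := by
  rw [checkSevenRestCols, ← List.range_eq_range'] at h₁
  rw [checkSevenRest, Bool.and_eq_true]
  exact ⟨h₁, h₂⟩

/-- A row from THREE column chunks `[0,m)`, `[m,j)`, `[j,p)` (all offsets as separate numerals, so that the per-prime files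
need no numeral arithmetic at elaboration). [folklore] -/
theorem checkSevenRow_of_cols3 {p : ℕ} {et tt : BTree} {b m n j k : ℕ} (hj : m + n = j) (hp : j + k = p)
    (h₁ : checkSevenRowCols p et tt b 0 m = true) (h₂ : checkSevenRowCols p et tt b m n = true)
    (h₃ : checkSevenRowCols p et tt b j k = true) : checkSevenRow p et tt b = true := by
  subst hj; subst hp
  rw [checkSevenRow_eq_cols]
  have h₂' : checkSevenRowCols (m + n + k) et tt b (0 + m) n = true := by rw [Nat.zero_add]; exact h₂
  have h₃' : checkSevenRowCols (m + n + k) et tt b (0 + (m + n)) k = true := by rw [Nat.zero_add]; exact h₃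
  exact checkSevenRowCols_split (checkSevenRowCols_split h₁ h₂') h₃'

/-- The rest check from THREE column chunks of its first family and the small families. [folklore] -/
theorem checkSevenRest_of_cols3 {p : ℕ} {et tt : BTree} {m n j k : ℕ} (hj : m + n = j) (hp : j + k = p)
    (h₁ : checkSevenRestCols p et tt 0 m = true) (h₂ : checkSevenRestCols p et tt m n = true)
    (h₃ : checkSevenRestCols p et tt j k = true) (hs : checkSevenRestSmall p et tt = true) :
    checkSevenRest p et tt = true := by
  subst hj; subst hp
  have h₂' : checkSevenRestCols (m + n + k) et tt (0 + m) n = true := by rw [Nat.zero_add]; exact h₂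
  have h₃' : checkSevenRestCols (m + n + k) et tt (0 + (m + n)) k = true := by rw [Nat.zero_add]; exact h₃
  exact checkSevenRest_of_parts (checkSevenRestCols_split (checkSevenRestCols_split h₁ h₂') h₃') hs

/-- Well-formedness of the excluded list (lengths `p`, digits `< 8`). [folklore] -/
def checkEwf7 (p : ℕ) (E : List (List ℕ)) : Bool := E.all fun k => (k.length == p) && k.all fun x => decide (x < 8)

/-- Entries of excluded keys are `≤ 3`. [folklore] -/
def checkE1seven (E : List (List ℕ)) : Bool := E.all fun k => k.all fun x => decide (x ≤ 3)

/-- `checkE1seven` ⇒ `hE1`. [folklore] -/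
theorem hE1seven_of_check {E : List (List ℕ)} (h : checkE1seven E = true) : ∀ k ∈ E, ∀ x ∈ k, x ≤ 3 := by
  intro k hk x hx
  simp only [checkE1seven, List.all_eq_true, decide_eq_true_eq] at h
  exact h k hk x hx

/-- **A successful lookup yields a table entry with that key.** [folklore] -/
theorem entry_of_lookup7 {p : ℕ} {T : List (List ℕ × List (ℕ × List ℕ))} {tt : BTree}
    (htt : ∀ x, tt.mem x = true → x ∈ T.map fun e => polyBE 8 e.1) (hWF : tabWF p 8 T = true) {n₀ n₁ n₂ n₃ n₄ n₅ n₆ : ℕ}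
    (h : tt.mem (hornerS 8 (cv7 p n₀ n₁ n₂ n₃ n₄ n₅ n₆) 0) = true) : ∃ e ∈ T, e.1 = cv7 p n₀ n₁ n₂ n₃ n₄ n₅ n₆ := by
  rw [hornerS_zero] at h
  have h2 := htt _ h
  rw [List.mem_map] at h2
  obtain ⟨e, he, hcode⟩ := h2
  simp only [tabWF, List.all_eq_true, Bool.and_eq_true, beq_iff_eq, decide_eq_true_eq] at hWF
  obtain ⟨helen, hedig⟩ := hWF e he
  refine ⟨e, he, polyBE_inj (by rw [helen, length_cv7]) hedig (fun x hx => ?_) hcode⟩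
  simp only [cv7, List.mem_map, List.mem_range] at hx
  obtain ⟨w, -, rfl⟩ := hx
  exact Nat.lt_succ_of_le (cnt7_le _ _ _ _ _ _ _ _)

/-- From `excluded-or-found` and `not excluded` to `found` (`et` sound for the codes of `E`). [folklore] -/
theorem lookup7_of_not_exc {p : ℕ} {E : List (List ℕ)} (hEwf : checkEwf7 p E = true) {et tt : BTree}
    (hEt' : ∀ x, et.mem x = true → x ∈ E.map (polyBE 8)) {n₀ n₁ n₂ n₃ n₄ n₅ n₆ : ℕ}
    (hk : cv7 p n₀ n₁ n₂ n₃ n₄ n₅ n₆ ∉ E) (h : okSeven p et tt n₀ n₁ n₂ n₃ n₄ n₅ n₆ = true) :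
    tt.mem (hornerS 8 (cv7 p n₀ n₁ n₂ n₃ n₄ n₅ n₆) 0) = true := by
  rw [okSeven] at h
  simp only [Bool.or_eq_true, hornerS_zero] at h ⊢
  refine h.resolve_left fun hc => hk ?_
  have hc' := hEt' _ hc
  rw [List.mem_map] at hc'
  obtain ⟨k, hkE, hcode⟩ := hc'
  simp only [checkEwf7, List.all_eq_true, Bool.and_eq_true, beq_iff_eq, decide_eq_true_eq] at hEwf
  obtain ⟨hlen, hdig⟩ := hEwf k hkE
  have e : k = cv7 p n₀ n₁ n₂ n₃ n₄ n₅ n₆ :=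
    polyBE_inj (by rw [hlen, length_cv7]) hdig (fun x hx => by
      simp only [cv7, List.mem_map, List.mem_range] at hx
      obtain ⟨w, -, rfl⟩ := hx
      exact Nat.lt_succ_of_le (cnt7_le _ _ _ _ _ _ _ _)) hcode
  exact e ▸ hkE

/-- Closure of `E` under the scaling `v ↦ g·v` checked through the SOUND code tree `et` of `E` (linear in `|E|`; the list
form `checkE2g` is quadratic and too slow in the kernel for `|E| = 760`). [folklore] -/
def checkE2gt (p g : ℕ) (E : List (List ℕ)) (et : BTree) : Bool :=
  !(g % p == 0) && (isGenB p g && E.all fun k => et.mem (polyBE 8 (scaleVec p g k)))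

/-- `checkE2gt` ⇒ `checkE2g` (tree soundness + injectivity of the codes on well-formed keys). [folklore] -/
theorem checkE2g_of_checkE2gt {p g : ℕ} {E : List (List ℕ)} {et : BTree} (hEwf : checkEwf7 p E = true)
    (hEt' : ∀ x, et.mem x = true → x ∈ E.map (polyBE 8)) (h : checkE2gt p g E et = true) : checkE2g p g E = true := by
  simp only [checkE2gt, Bool.and_eq_true, List.all_eq_true] at h
  obtain ⟨hg, hgen, hcl⟩ := h
  simp only [checkE2g, Bool.and_eq_true, List.all_eq_true, List.contains_iff_mem]
  refine ⟨hg, hgen, fun k hk => ?_⟩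
  have hm := hEt' _ (hcl k hk)
  rw [List.mem_map] at hm
  obtain ⟨k', hk', hcode⟩ := hm
  simp only [checkEwf7, List.all_eq_true, Bool.and_eq_true, beq_iff_eq, decide_eq_true_eq] at hEwf
  obtain ⟨hlen, hdig⟩ := hEwf k hk
  obtain ⟨hlen', hdig'⟩ := hEwf k' hk'
  have hlenS : (scaleVec p g k).length = p := by simp [scaleVec]
  have hdigS : ∀ x ∈ scaleVec p g k, x < 8 := by
    intro x hx
    simp only [scaleVec, List.mem_map, List.mem_range] at hx
    obtain ⟨w, -, rfl⟩ := hx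
    rw [List.getD_eq_getElem?_getD]
    cases hq : k[invMod p g * w % p]? with
    | none => simp
    | some y => simpa using hdig y (List.mem_of_getElem? hq)
  have e : k' = scaleVec p g k := polyBE_inj (by rw [hlen', hlenS]) hdig' hdigS hcode
  exact e ▸ hk'

/-- Chunking `checkE2gt` over the excluded list (one kernel decide must stay small). [folklore] -/
theorem checkE2gt_append {p g : ℕ} {E₁ E₂ : List (List ℕ)} {et : BTree} (h₁ : checkE2gt p g E₁ et = true)
    (h₂ : checkE2gt p g E₂ et = true) : checkE2gt p g (E₁ ++ E₂) et = true := by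
  simp only [checkE2gt, Bool.and_eq_true, List.all_append] at h₁ h₂ ⊢
  exact ⟨h₁.1, h₁.2.1, h₁.2.2, h₂.2.2⟩

/-- Chunking `checkR7` over the excluded list. [folklore] -/
theorem checkR7_append {p : ℕ} {E₁ E₂ R : List (List ℕ)} (h₁ : checkR7 p E₁ R = true) (h₂ : checkR7 p E₂ R = true) :
    checkR7 p (E₁ ++ E₂) R = true := by
  simp only [checkR7, List.all_append, Bool.and_eq_true] at h₁ h₂ ⊢
  exact ⟨h₁, h₂⟩

/-- Chunking `checkE1seven`. [folklore] -/
theorem checkE1seven_append {E₁ E₂ : List (List ℕ)} (h₁ : checkE1seven E₁ = true) (h₂ : checkE1seven E₂ = true) :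
    checkE1seven (E₁ ++ E₂) = true := by
  simp only [checkE1seven, List.all_append, Bool.and_eq_true] at h₁ h₂ ⊢
  exact ⟨h₁, h₂⟩

/-- Chunking `checkEwf7`. [folklore] -/
theorem checkEwf7_append {p : ℕ} {E₁ E₂ : List (List ℕ)} (h₁ : checkEwf7 p E₁ = true) (h₂ : checkEwf7 p E₂ = true) :
    checkEwf7 p (E₁ ++ E₂) = true := by
  simp only [checkEwf7, List.all_append, Bool.and_eq_true] at h₁ h₂ ⊢
  exact ⟨h₁, h₂⟩

variable {p : ℕ} [Fact p.Prime]

/-- The scaled count function read at `κ·v`. [folklore] -/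
theorem cnt7_scaled {κ : ZMod p} (hκ : κ ≠ 0) (a₀ a₁ a₂ a₃ a₄ a₅ a₆ v : ZMod p) :
    cnt7 (κ * a₀).val (κ * a₁).val (κ * a₂).val (κ * a₃).val (κ * a₄).val (κ * a₅).val (κ * a₆).val (κ * v).val =
      (if a₀ = v then 1 else 0) + (if a₁ = v then 1 else 0) + (if a₂ = v then 1 else 0) + (if a₃ = v then 1 else 0) +
        (if a₄ = v then 1 else 0) + (if a₅ = v then 1 else 0) + (if a₆ = v then 1 else 0) := by
  unfold cnt7
  simp only [(ZMod.val_injective p).eq_iff, mul_right_inj' hκ]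

/-- From a table entry keyed by the scaled values to the count identity at every `v`. [folklore] -/
theorem getD_entry_scaled7 {κ : ZMod p} (hκ : κ ≠ 0) (a₀ a₁ a₂ a₃ a₄ a₅ a₆ : ZMod p) {e : List ℕ × List (ℕ × List ℕ)}
    (he : e.1 = cv7 p (κ * a₀).val (κ * a₁).val (κ * a₂).val (κ * a₃).val (κ * a₄).val (κ * a₅).val (κ * a₆).val)
    (v : ZMod p) :
    e.1.getD (κ * v).val 0 =
      (if a₀ = v then 1 else 0) + (if a₁ = v then 1 else 0) + (if a₂ = v then 1 else 0) + (if a₃ = v then 1 else 0) +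
        (if a₄ = v then 1 else 0) + (if a₅ = v then 1 else 0) + (if a₆ = v then 1 else 0) := by
  rw [he, getD_cv7 p _ _ _ _ _ _ _ (ZMod.val_lt _), cnt7_scaled hκ]

/-- The count vector of the scaled tuple is the key of `κ·a`. [folklore] -/
theorem cv7_scaled_eq_key7 (κ : ZMod p) (a : Fin 7 → ZMod p) :
    cv7 p (κ * a 0).val (κ * a 1).val (κ * a 2).val (κ * a 3).val (κ * a 4).val (κ * a 5).val (κ * a 6).val =
      key7 (fun i => κ * a i) :=
  rfl

/-- **Normalisation**: a GOOD septuple, scaled by a suitable unit, is a normalised repeated tuple with a non-excluded count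
vector, so a table that passes `checkSeven` has an entry keyed by it. [folklore] -/
theorem exists_entry_of_goodS7 {E : List (List ℕ)} (hE2 : ∀ k ∈ E, ∀ κ : ℕ, 1 ≤ κ → κ < p → scaleVec p κ k ∈ E)
    {T : List (List ℕ × List (ℕ × List ℕ))} {tt : BTree}
    (htt : ∀ x, tt.mem x = true → x ∈ T.map fun e => polyBE 8 e.1) (hWF : tabWF p 8 T = true)
    (hEwf : checkEwf7 p E = true) {et : BTree} (hEt' : ∀ x, et.mem x = true → x ∈ E.map (polyBE 8))
    (hchk : checkSeven p et tt = true) {a : Fin 7 → ZMod p} (h01 : a 0 = a 1) (hgood : key7 a ∉ E) :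
    ∃ κ : ZMod p, κ ≠ 0 ∧ ∃ e ∈ T, ∀ v : ZMod p, e.1.getD (κ * v).val 0 =
      (if a 0 = v then 1 else 0) + (if a 1 = v then 1 else 0) + (if a 2 = v then 1 else 0) + (if a 3 = v then 1 else 0) +
        (if a 4 = v then 1 else 0) + (if a 5 = v then 1 else 0) + (if a 6 = v then 1 else 0) := by
  have hp1 : Fact (1 < p) := ⟨(Fact.out : p.Prime).one_lt⟩
  simp only [checkSeven, checkSevenRow, checkSevenRest, Bool.and_eq_true, List.all_eq_true, List.mem_range] at hchk
  obtain ⟨hA, hB, hC, hD, hE5, hF6, hZ⟩ := hchk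
  have hne : ∀ κ : ZMod p, κ ≠ 0 →
      cv7 p (κ * a 0).val (κ * a 1).val (κ * a 2).val (κ * a 3).val (κ * a 4).val (κ * a 5).val (κ * a 6).val ∉ E :=
    fun κ hκ hmem => by
      rw [cv7_scaled_eq_key7] at hmem
      exact hgood (key7_mem_of_smul_mem hE2 hκ a hmem)
  -- generic finishing step: given a unit `κ` and a successful lookup of the scaled tuple
  have finish : ∀ κ : ZMod p, κ ≠ 0 →
      tt.mem (hornerS 8 (cv7 p (κ * a 0).val (κ * a 1).val (κ * a 2).val (κ * a 3).val (κ * a 4).val (κ * a 5).val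
        (κ * a 6).val) 0) = true →
      ∃ κ : ZMod p, κ ≠ 0 ∧ ∃ e ∈ T, ∀ v : ZMod p, e.1.getD (κ * v).val 0 =
        (if a 0 = v then 1 else 0) + (if a 1 = v then 1 else 0) + (if a 2 = v then 1 else 0) + (if a 3 = v then 1 else 0) +
          (if a 4 = v then 1 else 0) + (if a 5 = v then 1 else 0) + (if a 6 = v then 1 else 0) := by
    intro κ hκ hlook
    obtain ⟨e, he, hkey⟩ := entry_of_lookup7 htt hWF hlook
    exact ⟨κ, hκ, e, he, getD_entry_scaled7 hκ _ _ _ _ _ _ _ hkey⟩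
  by_cases ha₀ : a 0 = 0
  · have ha₁ : a 1 = 0 := h01 ▸ ha₀
    by_cases ha₂ : a 2 = 0
    · by_cases ha₃ : a 3 = 0
      · by_cases ha₄ : a 4 = 0
        · by_cases ha₅ : a 5 = 0
          · by_cases ha₆ : a 6 = 0
            · refine finish 1 one_ne_zero (lookup7_of_not_exc hEwf hEt' (hne 1 one_ne_zero) ?_)
              rw [ha₀, ha₁, ha₂, ha₃, ha₄, ha₅, ha₆, mul_zero, ZMod.val_zero]; exact hZ
            · refine finish (a 6)⁻¹ (inv_ne_zero ha₆) (lookup7_of_not_exc hEwf hEt' (hne _ (inv_ne_zero ha₆)) ?_)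
              rw [ha₀, ha₁, ha₂, ha₃, ha₄, ha₅, mul_zero, ZMod.val_zero, inv_mul_cancel₀ ha₆, ZMod.val_one]; exact hF6
          · refine finish (a 5)⁻¹ (inv_ne_zero ha₅) (lookup7_of_not_exc hEwf hEt' (hne _ (inv_ne_zero ha₅)) ?_)
            rw [ha₀, ha₁, ha₂, ha₃, ha₄, mul_zero, ZMod.val_zero, inv_mul_cancel₀ ha₅, ZMod.val_one]
            exact hE5 _ (ZMod.val_lt _)
        · refine finish (a 4)⁻¹ (inv_ne_zero ha₄) (lookup7_of_not_exc hEwf hEt' (hne _ (inv_ne_zero ha₄)) ?_)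
          rw [ha₀, ha₁, ha₂, ha₃, mul_zero, ZMod.val_zero, inv_mul_cancel₀ ha₄, ZMod.val_one]
          exact hD _ (ZMod.val_lt _) _ (ZMod.val_lt _)
      · refine finish (a 3)⁻¹ (inv_ne_zero ha₃) (lookup7_of_not_exc hEwf hEt' (hne _ (inv_ne_zero ha₃)) ?_)
        rw [ha₀, ha₁, ha₂, mul_zero, ZMod.val_zero, inv_mul_cancel₀ ha₃, ZMod.val_one]
        exact hC _ (ZMod.val_lt _) _ (ZMod.val_lt _) _ (ZMod.val_lt _)
    · refine finish (a 2)⁻¹ (inv_ne_zero ha₂) (lookup7_of_not_exc hEwf hEt' (hne _ (inv_ne_zero ha₂)) ?_)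
      rw [ha₀, ha₁, mul_zero, ZMod.val_zero, inv_mul_cancel₀ ha₂, ZMod.val_one]
      exact hB _ (ZMod.val_lt _) _ (ZMod.val_lt _) _ (ZMod.val_lt _) _ (ZMod.val_lt _)
  · refine finish (a 0)⁻¹ (inv_ne_zero ha₀) (lookup7_of_not_exc hEwf hEt' (hne _ (inv_ne_zero ha₀)) ?_)
    rw [← h01, inv_mul_cancel₀ ha₀, ZMod.val_one]
    exact hA _ (ZMod.val_lt _) _ (ZMod.val_lt _) _ (ZMod.val_lt _) _ (ZMod.val_lt _) _ (ZMod.val_lt _)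

end Table

/-! ## Assembly -/

section Assembly

variable {p : ℕ} [Fact p.Prime]

/-- **Structural cover theorem for part `7`** (`p + 1 < 21`), all hypotheses on `E, R` as Bool checks plus the tree-completeness
fact (the `x`/`y`-arrangements of the pair checks are generated in the kernel, `DominoZpZpStructSevenGen.lean`): every value
function `g` of sum `7` on the `p²` points has a direction `j ≤ p`, a unit `k` and an entry `e ∈ T` with
`e.1[(k·v) % p] = (count of g along j at v)`. [folklore] -/
theorem exists_entry_structSeven_of_checks (hp : p + 1 < 21) (E R : List (List ℕ)) (g₀ : ℕ) (et : BTree)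
    (h1 : checkE1seven E = true) (h2 : checkE2g p g₀ E = true) (hR : checkR7 p E R = true)
    (hEt : ∀ k ∈ E, et.mem (polyBE 8 k) = true)
    (h3a : ∀ k ∈ R, checkH7a p et R k = true) (h3b : ∀ k ∈ R, checkH7b p et R k = true)
    (T : List (List ℕ × List (ℕ × List ℕ))) (tt : BTree)
    (htt : ∀ x, tt.mem x = true → x ∈ T.map fun e => polyBE 8 e.1) (hWF : tabWF p 8 T = true)
    (hEwf : checkEwf7 p E = true) (hEt' : ∀ x, et.mem x = true → x ∈ E.map (polyBE 8))
    (hchk : checkSeven p et tt = true) (g : Fin (p * p) → ℕ) (hg : ∑ i, g i = 7) :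
    ∃ j < p + 1, ∃ k : ℕ, k % p ≠ 0 ∧ ∃ e ∈ T, ∀ v < p,
      e.1.getD (k * v % p) 0 = ∑ i : Fin (p * p), pick v (pv p j i.val) (g i) := by
  haveI : NeZero p := ⟨(Fact.out : p.Prime).ne_zero⟩
  have hE1 := hE1seven_of_check h1
  have hE2 := hE2_of_checkE2g h2
  have hR' := hR7_of_check hR
  set H : ZMod p × ZMod p → ℕ := fun w => g ((ptEquiv p).symm w) with hH
  have hsum : ∑ w, H w = 7 := by
    rw [← hg]
    exact Fintype.sum_equiv (ptEquiv p).symm H g fun w => rfl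
  obtain ⟨u, hu⟩ := exists_tuple_of_sum_eq 7 H hsum
  obtain ⟨j, hj, σ, h01, hgood⟩ := exists_goodS7 hp E hE1 hE2
    (h3a_of_checkH7a hE2 hR' hEt h3a) (h3b_of_checkH7b hE2 hR' hEt h3b) u
  have hcnt : ∀ v < p, ∑ i : Fin (p * p), pick v (pv p j i.val) (g i) =
      ∑ i : Fin 7, if lineDir p j (u (σ i)) = ((v : ℕ) : ZMod p) then 1 else 0 := by
    intro v hv
    have e1 := sum_filter_eq_sum_pick p j H hv
    have e2 : ∀ i : Fin (p * p), H (pt p i.val) = g i := fun i => by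
      show g ((ptEquiv p).symm (ptEquiv p i)) = g i
      rw [Equiv.symm_apply_apply]
    simp only [e2] at e1
    rw [← e1]
    simp only [hu]
    rw [sum_filter_tuple_count u (lineDir p j) ((v : ℕ) : ZMod p)]
    exact (Equiv.sum_comp σ (fun i => if lineDir p j (u i) = ((v : ℕ) : ZMod p) then 1 else 0)).symm
  obtain ⟨κ, hκ, e, he, hev⟩ :=
    exists_entry_of_goodS7 hE2 htt hWF hEwf hEt' hchk (a := fun i => lineDir p j (u (σ i))) h01 hgood
  refine ⟨j, hj, κ.val, ?_, e, he, fun v hv => ?_⟩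
  · rw [Nat.mod_eq_of_lt (ZMod.val_lt κ)]
    exact (ZMod.val_ne_zero κ).2 hκ
  · rw [hcnt v hv, Fin.sum_univ_seven]
    have h1 := hev ((v : ℕ) : ZMod p)
    rw [ZMod.val_mul, ZMod.val_natCast, Nat.mod_eq_of_lt hv] at h1
    exact h1

end Assembly

end ZpZpDomino

end Summit.MatrixMultiplication.OmegaCensus
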